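import Summits.PneNP.PneNP.Theorems.ChebyshevTracialDesignTightEigenDecay
import HarnessLib

/-!
# Cell pnp-psdrank, route `ChebyshevTracialDesign`: the even tight eigenvalues in PRODUCT form (MEMO-7 §E (P)) —
# the tight-level attenuation `σ_{2κ}(1)² = λ_{2κ}/λ₀` exactly

Harmonic backbone of the `r = 1` rung of the crux `TracialDecayExp20` (stmt-PneNP-19878), brick 5i. Telescoping eng g7's
increment identity `…TightEvenRatio.kernelEigen_tight_even_succ_mul` (p449566) from `κ' = 0` gives MEMO-7(prover) §E (P)
(checked there on 1330 exact cases) as a tree theorem: for `n` even, `t = 2c+1`, `2t ≤ n`, `κ' ≤ c` and `κ` the Gram class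
function of the tight incidence `1[cc(U,M) = 1]` on the `t`-subsets [cite: Rothvoss2017, §2 (PDF p. 6)],
* `kernelEigen_tight_even_prod_eq` :
  `λ_{2κ'} · Π_{i<κ'} (n−2i)(t−2i)(n−t−2i) = λ₀ · Π_{i<κ'} (2i+1)(t−1−2i)(n−t−1−2i)`,
  i.e. `λ_{2κ'}/λ₀ = (2κ'−1)‼ · Π_{i<κ'} (t−1−2i)(n−t−1−2i) / ((t−2i)(n−t−2i)(n−2i))` (`κ' = 1`: brick 5g, p446018);
* `kernelEigen_tight_even_le_prod` : `λ_{2κ'} ≤ λ₀ · Π_{i<κ'} (2i+1)/(n−2i)` — the normalised singular values of the TIGHT level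
  satisfy `σ_{2κ'}(1)² = λ_{2κ'}/λ₀ ≤ (2κ'−1)‼/Π_{i<κ'}(n−2i)`, the sharp form of R1-SKELETON S4 (F3) / S3(iii) at `c = 1`
  (eng's level-uniform dipole-hit bound `kernelEigen_ratio_le_of_hit`, p447163, is `C(4κ',2κ')·16^{κ'}` times weaker there).
[cite: GodsilMeagher2015, §15.2 (perfect matching scheme)] Stature: support/instrument. WHAT THIS IS NOT: nothing on the other
levels `c ≥ 3`, nothing on psd rank, no P-vs-NP content. Supports crux stmt-PneNP-19878.
-/

set_option linter.dupNamespace false -- `Summit.PneNP.PneNP.…`: summit = sub-problem (D-0017)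

noncomputable section

namespace Summit.PneNP.PneNP.Theorems.ChebyshevTracialDesignTightEvenProduct

open Finset Literature.Combinatorics.AssociationSchemes Literature.Combinatorics.AssociationSchemes.JohnsonHarmonics
open Literature.Combinatorics.AssociationSchemes.JohnsonSpectrum
open Literature.Barriers.PneNP
open Summit.PneNP.PneNP.Theorems.ChebyshevTracialDesignTightEvenRatio
open Summit.PneNP.PneNP.Theorems.ChebyshevTracialDesignTightEigenDecay

variable {n : ℕ}

/-- **(P), product form.** For `n` even, `t = 2c+1`, `2t ≤ n`, `κ' ≤ c`:
`λ_{2κ'} · Π_{i<κ'} (n−2i)(t−2i)(n−t−2i) = λ₀ · Π_{i<κ'} (2i+1)(t−1−2i)(n−t−1−2i)`.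
[cite: GodsilMeagher2015, §15.2 (perfect matching scheme)] -/
theorem kernelEigen_tight_even_prod_eq {c κ' : ℕ} (hn : Even n) (ht : 2 * (2 * c + 1) ≤ n) (hκc : κ' ≤ c) (κ : ℕ → ℝ)
    (hA : ∀ U ∈ univ.powersetCard (2 * c + 1), ∀ U' ∈ univ.powersetCard (2 * c + 1),
      ∑ M : PMatch n, (if (U.filter fun x => M.2.partner x ∉ U).card = 1 then (1 : ℝ) else 0) *
        (if (U'.filter fun x => M.2.partner x ∉ U').card = 1 then (1 : ℝ) else 0) = κ (U ∩ U').card) :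
    kernelEigen n (2 * c + 1) (2 * κ') κ *
        ∏ i ∈ range κ', (((n : ℝ) - 2 * i) * ((2 * c + 1 : ℝ) - 2 * i) * ((n : ℝ) - (2 * c + 1) - 2 * i)) =
      kernelEigen n (2 * c + 1) 0 κ *
        ∏ i ∈ range κ', ((2 * i + 1 : ℝ) * ((2 * c : ℝ) - 2 * i) * ((n : ℝ) - (2 * c + 2) - 2 * i)) := by
  induction κ' with
  | zero => simp
  | succ k ih =>
    have hk : k ≤ c := by omega
    rw [prod_range_succ, prod_range_succ, ← mul_assoc, mul_comm (kernelEigen n (2 * c + 1) (2 * (k + 1)) κ),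
      mul_assoc, kernelEigen_tight_even_succ_mul hn ht hκc κ hA, ← mul_assoc,
      mul_comm _ (kernelEigen n (2 * c + 1) (2 * k) κ), ih hk]
    ring

/-- **Tight-level attenuation, sharp form.** For `n` even, `t = 2c+1`, `2t ≤ n`, `κ' ≤ c`:
`λ_{2κ'} ≤ λ₀ · Π_{i<κ'} (2i+1)/(n−2i)`, i.e. `σ_{2κ'}(1)² = λ_{2κ'}/λ₀ ≤ (2κ'−1)‼/Π_{i<κ'}(n−2i)`. -/
theorem kernelEigen_tight_even_le_prod {c κ' : ℕ} (hn : Even n) (ht : 2 * (2 * c + 1) ≤ n) (hκc : κ' ≤ c) (κ : ℕ → ℝ)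
    (hA : ∀ U ∈ univ.powersetCard (2 * c + 1), ∀ U' ∈ univ.powersetCard (2 * c + 1),
      ∑ M : PMatch n, (if (U.filter fun x => M.2.partner x ∉ U).card = 1 then (1 : ℝ) else 0) *
        (if (U'.filter fun x => M.2.partner x ∉ U').card = 1 then (1 : ℝ) else 0) = κ (U ∩ U').card) :
    kernelEigen n (2 * c + 1) (2 * κ') κ ≤
      kernelEigen n (2 * c + 1) 0 κ * ∏ i ∈ range κ', ((2 * i + 1 : ℝ) / ((n : ℝ) - 2 * i)) := by
  induction κ' with
  | zero => simp
  | succ k ih =>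
    have hk : k ≤ c := by omega
    have hn' : ((4 * c + 2 : ℕ) : ℝ) ≤ n := by exact_mod_cast (show 4 * c + 2 ≤ n by omega)
    have hkc : ((k : ℕ) : ℝ) + 1 ≤ c := by exact_mod_cast (show k + 1 ≤ c from hκc)
    push_cast at hn'
    have hq : (0 : ℝ) ≤ (2 * k + 1 : ℝ) / ((n : ℝ) - 2 * k) :=
      div_nonneg (by positivity) (by linarith)
    calc kernelEigen n (2 * c + 1) (2 * (k + 1)) κ
        ≤ kernelEigen n (2 * c + 1) (2 * k) κ * ((2 * k + 1 : ℝ) / ((n : ℝ) - 2 * k)) :=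
          kernelEigen_tight_even_succ_le hn ht hκc κ hA
      _ ≤ (kernelEigen n (2 * c + 1) 0 κ * ∏ i ∈ range k, ((2 * i + 1 : ℝ) / ((n : ℝ) - 2 * i))) *
            ((2 * k + 1 : ℝ) / ((n : ℝ) - 2 * k)) := mul_le_mul_of_nonneg_right (ih hk) hq
      _ = kernelEigen n (2 * c + 1) 0 κ * ∏ i ∈ range (k + 1), ((2 * i + 1 : ℝ) / ((n : ℝ) - 2 * i)) := by
          rw [prod_range_succ]; ring

/-- **Normalised form**: `λ_{2κ'}/λ₀ ≤ Π_{i<κ'} (2i+1)/(n−2i)` (`λ₀ > 0`). -/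
theorem kernelEigen_tight_even_div_le_prod {c κ' : ℕ} (hn : Even n) (ht : 2 * (2 * c + 1) ≤ n) (hκc : κ' ≤ c)
    (κ : ℕ → ℝ)
    (hA : ∀ U ∈ univ.powersetCard (2 * c + 1), ∀ U' ∈ univ.powersetCard (2 * c + 1),
      ∑ M : PMatch n, (if (U.filter fun x => M.2.partner x ∉ U).card = 1 then (1 : ℝ) else 0) *
        (if (U'.filter fun x => M.2.partner x ∉ U').card = 1 then (1 : ℝ) else 0) = κ (U ∩ U').card) :
    kernelEigen n (2 * c + 1) (2 * κ') κ / kernelEigen n (2 * c + 1) 0 κ ≤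
      ∏ i ∈ range κ', ((2 * i + 1 : ℝ) / ((n : ℝ) - 2 * i)) := by
  rw [div_le_iff₀ (kernelEigen_tight_zero_pos hn ht κ hA)]
  exact (kernelEigen_tight_even_le_prod hn ht hκc κ hA).trans_eq (mul_comm _ _)

end Summit.PneNP.PneNP.Theorems.ChebyshevTracialDesignTightEvenProduct
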